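import Mathlib
import Summits.NavierStokesRegularity.NavierStokesRegularity.Theorems.EulerZoomLiouvillePowerGaugeEulerLiouvilleQVorticityTools
import Summits.NavierStokesRegularity.NavierStokesRegularity.Theorems.EulerZoomLiouvillePowerGaugeEulerLiouvilleVorticitySupportLimits
import HarnessLib

/-!
# The `q`-power of the vorticity along classical Euler flows with a moving weight — the limit `ε → 0`
# (helper of the DSS vorticity-decay stratum of the crux `EulerZoomLiouville.PowerGaugeEulerLiouville`,
# route №10, item stmt-NavierStokesRegularity-19832)

Helper file (theorems only; `--supports stmt-NavierStokesRegularity-19832`). Seat ns-typeII-p3 (cell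
ns-regularity-ideate §B, D-0081). Sequel of `…QVorticityTools.lean`: in the cut-off identity
`integral_cutoff_weight_qpow_sub_eq` at `ε = 1/(j+1)` we pass `j → ∞` by dominated convergence on the
space-time slab (pointwise `(|ω|²+ε)^{q/2} → |ω|^q`, `(|ω|²+ε)^{q/2−1}⟪ω, Aω⟫ → |ω|^q ⟪ξ, Aξ⟫`,
`ξ = ω/|ω|`, both dominated by `‖A‖ (|ω|²+1)^{q/2}` on the support of the cut-off), obtaining
(`integral_cutoff_weight_rpow_sub_eq`), for every `q > 0`, jointly smooth weight `Θ` and `R > 0`,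
`½∫χ_R Θ(T)²|ω(T)|^q − ½∫χ_R Θ(0)²|ω(0)|^q
   = ∫₀ᵀ (½∫Dχ_R[u]Θ²|ω|^q + ∫χ_R[(q/2)Θ²|ω|^q⟪ξ, Du ξ⟫ + Θ|ω|^q(∂ₜΘ + DΘ[u])]) dσ`.
The limit `R → ∞` is the sequel `…QVorticityIdentity.lean`.

WHAT THIS IS NOT: not NS, not the crux — a calculus identity for classical Euler flows (the physical-variable
form of the multiplier `Ω|Ω|^{q−2}σ` computation of Chae–Tsai, MRL 21 (2014) §2). [folklore]
-/

noncomputable section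

-- the summit and its single problem share the name `NavierStokesRegularity` (D-0017 nested layout)
set_option linter.dupNamespace false

open Set Function Filter Topology MeasureTheory Metric
open scoped NNReal ENNReal InnerProductSpace RealInnerProductSpace

namespace Summit.NavierStokesRegularity.NavierStokesRegularity.Theorems.PowerGaugeEulerLiouville.VorticityDecay

open Literature.Analysis Literature.Analysis.FluidPDE
open Summit.NavierStokesRegularity.NavierStokesRegularity.Theorems.PowerGaugeEulerLiouville.VorticitySupport

/-! ## Pointwise tools -/

/-- The sequence `ε_j = 1/(j+1) → 0`. [folklore] -/
theorem tendsto_inv_natCast_add_one : Tendsto (fun j : ℕ => ((j : ℝ) + 1)⁻¹) atTop (𝓝 0) :=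
  tendsto_inv_atTop_zero.comp (tendsto_natCast_atTop_atTop.atTop_add tendsto_const_nhds)

/-- Monotonicity in `ε ≤ 1`: `(|w|²+ε)^a ≤ (|w|²+1)^a` for `a ≥ 0`. [folklore] -/
theorem qpow_le_qpow_one {ε a : ℝ} (hε : 0 < ε) (hε1 : ε ≤ 1) (ha : 0 ≤ a) (w : EuclideanSpace ℝ (Fin 3)) :
    (‖w‖ ^ 2 + ε) ^ a ≤ (‖w‖ ^ 2 + 1) ^ a :=
  Real.rpow_le_rpow (by positivity) (by linarith) ha

/-- **Bound for the regularised source**: `|(|w|²+ε)^{a−1}⟪w, Aw⟫| ≤ ‖A‖ (|w|²+ε)^a`. [folklore] -/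
theorem abs_qsource_le {ε a : ℝ} (hε : 0 < ε) (w : EuclideanSpace ℝ (Fin 3))
    (A : (EuclideanSpace ℝ (Fin 3)) →L[ℝ] (EuclideanSpace ℝ (Fin 3))) :
    |(‖w‖ ^ 2 + ε) ^ (a - 1) * ⟪w, A w⟫| ≤ ‖A‖ * (‖w‖ ^ 2 + ε) ^ a := by
  have hden : 0 < ‖w‖ ^ 2 + ε := by positivity
  have h1 : |⟪w, A w⟫| ≤ ‖A‖ * (‖w‖ ^ 2 + ε) := by
    calc |⟪w, A w⟫| ≤ ‖w‖ * ‖A w‖ := abs_real_inner_le_norm _ _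
      _ ≤ ‖w‖ * (‖A‖ * ‖w‖) := by gcongr; exact A.le_opNorm w
      _ = ‖A‖ * ‖w‖ ^ 2 := by ring
      _ ≤ ‖A‖ * (‖w‖ ^ 2 + ε) := by gcongr; linarith
  rw [abs_mul, abs_of_pos (Real.rpow_pos_of_pos hden _)]
  calc (‖w‖ ^ 2 + ε) ^ (a - 1) * |⟪w, A w⟫| ≤ (‖w‖ ^ 2 + ε) ^ (a - 1) * (‖A‖ * (‖w‖ ^ 2 + ε)) := by
        gcongr
    _ = ‖A‖ * ((‖w‖ ^ 2 + ε) ^ (a - 1) * (‖w‖ ^ 2 + ε)) := by ring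
    _ = ‖A‖ * (‖w‖ ^ 2 + ε) ^ a := by rw [Real.rpow_sub_one hden.ne', div_mul_cancel₀ _ hden.ne']

/-- **Pointwise limit**: `(|w|²+ε_j)^{q/2} → |w|^q` (`q > 0`). [folklore] -/
theorem tendsto_qpow {q : ℝ} (hq : 0 < q) (w : EuclideanSpace ℝ (Fin 3)) :
    Tendsto (fun j : ℕ => (‖w‖ ^ 2 + ((j : ℝ) + 1)⁻¹) ^ (q / 2)) atTop (𝓝 (‖w‖ ^ q)) := by
  have h1 : Tendsto (fun j : ℕ => ‖w‖ ^ 2 + ((j : ℝ) + 1)⁻¹) atTop (𝓝 (‖w‖ ^ 2 + 0)) :=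
    tendsto_const_nhds.add tendsto_inv_natCast_add_one
  rw [add_zero] at h1
  have h2 := h1.rpow_const (p := q / 2) (Or.inr (by positivity))
  have e : (‖w‖ ^ 2) ^ (q / 2) = ‖w‖ ^ q := by
    rw [← Real.rpow_natCast ‖w‖ 2, ← Real.rpow_mul (norm_nonneg _)]
    congr 1; push_cast; ring
  rwa [e] at h2

/-- **Pointwise limit of the source**: `(|w|²+ε_j)^{q/2−1}⟪w, Aw⟫ → |w|^q ⟪ξ, Aξ⟫`, `ξ = w/|w|`
(`q > 0`; both sides vanish at `w = 0`). [folklore] -/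
theorem tendsto_qsource {q : ℝ} (hq : 0 < q) (w : EuclideanSpace ℝ (Fin 3))
    (A : (EuclideanSpace ℝ (Fin 3)) →L[ℝ] (EuclideanSpace ℝ (Fin 3))) :
    Tendsto (fun j : ℕ => (‖w‖ ^ 2 + ((j : ℝ) + 1)⁻¹) ^ (q / 2 - 1) * ⟪w, A w⟫) atTop
      (𝓝 (‖w‖ ^ q * ⟪‖w‖⁻¹ • w, A (‖w‖⁻¹ • w)⟫)) := by
  by_cases hw : w = 0
  · subst hw
    simp [Real.zero_rpow hq.ne']
  · have hn : 0 < ‖w‖ := norm_pos_iff.2 hw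
    have h1 : Tendsto (fun j : ℕ => ‖w‖ ^ 2 + ((j : ℝ) + 1)⁻¹) atTop (𝓝 (‖w‖ ^ 2 + 0)) :=
      tendsto_const_nhds.add tendsto_inv_natCast_add_one
    rw [add_zero] at h1
    have h2 := (h1.rpow_const (p := q / 2 - 1) (Or.inl (by positivity))).mul_const ⟪w, A w⟫
    have e : (‖w‖ ^ 2) ^ (q / 2 - 1) * ⟪w, A w⟫ = ‖w‖ ^ q * ⟪‖w‖⁻¹ • w, A (‖w‖⁻¹ • w)⟫ := by
      rw [map_smul, inner_smul_left, inner_smul_right, ← Real.rpow_natCast ‖w‖ 2,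
        ← Real.rpow_mul (norm_nonneg _)]
      simp only [conj_trivial]
      have e2 : ((2 : ℕ) : ℝ) * (q / 2 - 1) = q - 2 := by push_cast; ring
      rw [e2, Real.rpow_sub hn, Real.rpow_two]
      field_simp
    rwa [e] at h2

/-! ## Dominated convergence in `ε = 1/(j+1)` on slices -/

/-- **Slice limit of the power**: `∫ ψ (|w|²+ε_j)^{q/2} → ∫ ψ |w|^q` for a continuous field `w` and a
continuous compactly supported weight `ψ` (`q > 0`). [folklore] -/
theorem tendsto_integral_mul_qpow {q : ℝ} (hq : 0 < q) {w : (EuclideanSpace ℝ (Fin 3)) → (EuclideanSpace ℝ (Fin 3))}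
    (hw : Continuous w) {ψ : (EuclideanSpace ℝ (Fin 3)) → ℝ} (hψ : Continuous ψ) (hψc : HasCompactSupport ψ) :
    Tendsto (fun j : ℕ => ∫ x, ψ x * (‖w x‖ ^ 2 + ((j : ℝ) + 1)⁻¹) ^ (q / 2)) atTop
      (𝓝 (∫ x, ψ x * ‖w x‖ ^ q)) := by
  have hbd : Continuous fun x => (‖w x‖ ^ 2 + 1) ^ (q / 2) :=
    ((hw.norm.pow 2).add continuous_const).rpow_const fun x => Or.inr (by positivity)
  refine tendsto_integral_of_dominated_convergence (fun x => ‖ψ x‖ * (‖w x‖ ^ 2 + 1) ^ (q / 2)) ?_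
    ((hψ.norm.mul hbd).integrable_of_hasCompactSupport hψc.norm.mul_right) ?_ ?_
  · intro j
    have hj : (0 : ℝ) < ((j : ℝ) + 1)⁻¹ := by positivity
    exact (hψ.mul (((hw.norm.pow 2).add continuous_const).rpow_const fun x =>
      Or.inl (add_pos_of_nonneg_of_pos (sq_nonneg _) hj).ne')).aestronglyMeasurable
  · intro j
    have hj : (0 : ℝ) < ((j : ℝ) + 1)⁻¹ := by positivity
    have hj1 : ((j : ℝ) + 1)⁻¹ ≤ 1 := inv_le_one_of_one_le₀ (by linarith [j.cast_nonneg (α := ℝ)])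
    refine Eventually.of_forall fun x => ?_
    rw [norm_mul, Real.norm_of_nonneg (Real.rpow_nonneg (by positivity) _)]
    exact mul_le_mul_of_nonneg_left (qpow_le_qpow_one hj hj1 (by positivity) (w x)) (norm_nonneg _)
  · exact Eventually.of_forall fun x => (tendsto_qpow hq (w x)).const_mul (ψ x)

/-- **Slice limit of the source**: `∫ ψ (|w|²+ε_j)^{q/2−1}⟪w, A w⟫ → ∫ ψ |w|^q ⟪ξ, A ξ⟫` for continuous
`w`, `A`, `ψ` with `ψ` compactly supported (`q > 0`). [folklore] -/
theorem tendsto_integral_mul_qsource {q : ℝ} (hq : 0 < q)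
    {w : (EuclideanSpace ℝ (Fin 3)) → (EuclideanSpace ℝ (Fin 3))} (hw : Continuous w)
    {A : (EuclideanSpace ℝ (Fin 3)) → (EuclideanSpace ℝ (Fin 3)) →L[ℝ] (EuclideanSpace ℝ (Fin 3))}
    (hA : Continuous A) {ψ : (EuclideanSpace ℝ (Fin 3)) → ℝ} (hψ : Continuous ψ) (hψc : HasCompactSupport ψ) :
    Tendsto (fun j : ℕ => ∫ x, ψ x * ((‖w x‖ ^ 2 + ((j : ℝ) + 1)⁻¹) ^ (q / 2 - 1) * ⟪w x, A x (w x)⟫))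
      atTop (𝓝 (∫ x, ψ x * (‖w x‖ ^ q * ⟪‖w x‖⁻¹ • w x, A x (‖w x‖⁻¹ • w x)⟫))) := by
  have hbd : Continuous fun x => ‖A x‖ * (‖w x‖ ^ 2 + 1) ^ (q / 2) :=
    hA.norm.mul (((hw.norm.pow 2).add continuous_const).rpow_const fun x => Or.inr (by positivity))
  refine tendsto_integral_of_dominated_convergence (fun x => ‖ψ x‖ * (‖A x‖ * (‖w x‖ ^ 2 + 1) ^ (q / 2))) ?_
    ((hψ.norm.mul hbd).integrable_of_hasCompactSupport hψc.norm.mul_right) ?_ ?_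
  · intro j
    have hj : (0 : ℝ) < ((j : ℝ) + 1)⁻¹ := by positivity
    exact (hψ.mul ((((hw.norm.pow 2).add continuous_const).rpow_const fun x =>
      Or.inl (add_pos_of_nonneg_of_pos (sq_nonneg _) hj).ne').mul (hw.inner (hA.clm_apply hw)))).aestronglyMeasurable
  · intro j
    have hj : (0 : ℝ) < ((j : ℝ) + 1)⁻¹ := by positivity
    have hj1 : ((j : ℝ) + 1)⁻¹ ≤ 1 := inv_le_one_of_one_le₀ (by linarith [j.cast_nonneg (α := ℝ)])
    refine Eventually.of_forall fun x => ?_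
    rw [norm_mul, Real.norm_eq_abs (_ * _)]
    gcongr
    exact (abs_qsource_le (a := q / 2) hj (w x) (A x)).trans
      (mul_le_mul_of_nonneg_left (qpow_le_qpow_one hj hj1 (by positivity) (w x)) (norm_nonneg _))
  · exact Eventually.of_forall fun x => (tendsto_qsource hq (w x) (A x)).const_mul (ψ x)

end Summit.NavierStokesRegularity.NavierStokesRegularity.Theorems.PowerGaugeEulerLiouville.VorticityDecay

end
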